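import Summits.Langlands.Langlands.Theorems.ParityBlindBianchiIcosahedralDescentLevelMain
import Summits.Langlands.Langlands.Theorems.IcosahedralDescentLevel.Negative.DoorOfInhabited

/-!
# Status of the crux `IcosahedralDescentLevel` (stmt-Langlands-15113) AS TYPED: two exact equivalences

The line `Sketch` has landed the REPAIRED crux D″ (`0 ∉ S₀`) modulo the tree's four Arthur–Clozel
named facts (`icosahedralDescentLevel_repaired`, `…IcosahedralDescentLevelMain`), and the refuters
have landed the exact decomposition `typed ↔ repaired ∧ door`
(`Negative.icosahedralDescentLevel_iff_repaired_and_door`) and `typed → inhabited → all-parity Artin`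
(`Negative.allParity_of_descent_of_inhabited`).  This file records what is therefore left of the TYPED
crux, as two kernel-checked equivalences (lead prover, continuation seat c1):

* `iff_door_of_facts` — granted F1–F4, the typed crux is EQUIVALENT to its door: strong Artin (a.e.)
  for every irreducible icosahedral `ρ/ℚ`, odd or even, given only a 2-adic model of `ρ|_K` and SOME
  cuspidal datum on `GL₂/K` for every 2-split imaginary quadratic `K`;
* `iff_allParityArtin_of_inhabited` — granted only bare cuspidal inhabitation over the 2-split
  imaginary quadratic fields (true; no cusp form is yet constructed in the tree's Borel–Jacquet model),
  the typed crux is EQUIVALENT to all-parity icosahedral strong Artin over `ℚ` — the route's rank-0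
  target `EvenIcosahedralStrongArtin` with its evenness hypothesis deleted.  No base-change fact enters:
  the uniform-family hypothesis of the typed crux contributes nothing.

Hence no line can close the crux as typed short of the (open) even icosahedral Artin conjecture; the
item is misstated and the repair `∃ S₀, 0 ∉ S₀ ∧ …` (D″) is complete.
-/

-- `Summit.Langlands.Langlands.…`: the repeated path component is the tree's layout (D-0017).
set_option linter.dupNamespace false

noncomputable section

open scoped MatrixGroups NumberField
open NumberField IsDedekindDomain Field Filter
open Literature.NumberTheory.Automorphic Literature.NumberTheory.GaloisRepresentations
open Summit.Langlands.Langlands.Theses.ParityBlindBianchi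

namespace Summit.Langlands.Langlands.Theorems.IcosahedralDescentLevel

/-- **Granted F1–F4, the typed crux is exactly its door.**  With the four Arthur–Clozel facts of the
tree (F1 `cuspidal_descent_cyclic`, F2 `ArthurClozel1989_strongLifting_unramified`, F3
`baseChange_cyclic_cuspidal`, F4 `ArthurClozel_fibres_quadratic`) the repaired conjunct of
`Negative.icosahedralDescentLevel_iff_repaired_and_door` is the landed theorem
`icosahedralDescentLevel_repaired`, so `IcosahedralDescentLevel` as typed is equivalent to the door
alone: a.e. strong Artin for EVERY irreducible icosahedral `ρ/ℚ` granted bare per-field data (a 2-adic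
model and some cuspidal datum over each 2-split imaginary quadratic `K`). [folklore] -/
theorem iff_door_of_facts (hdesc : cuspidal_descent_cyclic)
    (hSL : ArthurClozel1989_strongLifting_unramified) (hBC : baseChange_cyclic_cuspidal)
    (hfib : ArthurClozel_fibres_quadratic) :
    IcosahedralDescentLevel ↔
      ∀ (ι : PadicAlgCl 2 ≃+* ℂ) (ρ : FramedGaloisRep ℚ ℂ 2), ρ.toGaloisRep.IsIrreducible →
        Nonempty ((Matrix.ProjGenLinGroup.mk.comp ρ.toMonoidHom).range ≃* alternatingGroup (Fin 5)) →
        (∀ (K : Type) [Field K] [NumberField K], NumberField.IsTotallyComplex K →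
          Module.finrank ℚ K = 2 →
          (∃ v w : HeightOneSpectrum (𝓞 K), v ≠ w ∧ ((2 : ℕ) : 𝓞 K) ∈ v.asIdeal ∧
            ((2 : ℕ) : 𝓞 K) ∈ w.asIdeal) →
          ∃ (σ : FramedGaloisRep K (PadicAlgCl 2) 2) (hcpt : isCompact_glFiniteIntegralLevel 2 K)
            (_π : CuspidalAutomorphicRepData 2 K hcpt),
            ∀ (g : absoluteGaloisGroup K) (i j : Fin 2),
              ι ((σ g).val i j) = ((FramedGaloisRep.restrictField K ρ) g).val i j) →
        ∃ (hcpt : isCompact_glFiniteIntegralLevel 2 ℚ) (π : CuspidalAutomorphicRepData 2 ℚ hcpt),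
          ∀ᶠ v : HeightOneSpectrum (𝓞 ℚ) in cofinite, ∃ α : Multiset ℂ,
            π.1.HasSatakeParamAt v α ∧ ρ.IsUnramifiedAt v ∧
              ρ.HasFrobCharpolyAt v (satakePolynomial α) := by
  rw [Negative.icosahedralDescentLevel_iff_repaired_and_door]
  exact ⟨fun h => h.2, fun h => ⟨fun ι ρ _ _ ⟨S₀, h0, hK⟩ =>
    icosahedralDescentLevel_repaired hdesc hSL hBC hfib ι ρ S₀ h0 hK, h⟩⟩

/-- **Granted bare cuspidal inhabitation, the typed crux IS all-parity icosahedral strong Artin.**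
If every imaginary quadratic `K` with `2` split carries SOME cuspidal automorphic representation datum
of `GL₂(𝔸_K)` (true — base change of any non-CM weight-2 newform — but not yet constructed in the
tree), then `IcosahedralDescentLevel` as typed is EQUIVALENT to: every irreducible `ρ : Γ_ℚ → GL₂(ℂ)`
with projective image `A₅`, of either parity, has a cuspidal `π` on `GL₂(𝔸_ℚ)` with
`satakePolynomial (t_{π,v}) = charpoly ρ(Frob_v)` at cofinitely many `v` — the route target
`EvenIcosahedralStrongArtin` with its evenness hypothesis deleted.  (→) is the refuters'
`Negative.allParity_of_descent_of_inhabited` (junk bad set `S₀ = {0}`, free 2-adic models, Steinitz);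
(←) all-parity strong Artin is the conclusion of the crux for `ρ`, its hypotheses unused.  No
base-change fact is used: the uniform-family hypothesis of the typed crux carries no information.
[folklore] -/
theorem iff_allParityArtin_of_inhabited
    (hinh : ∀ (K : Type) [Field K] [NumberField K], NumberField.IsTotallyComplex K →
      Module.finrank ℚ K = 2 →
      (∃ v w : HeightOneSpectrum (𝓞 K), v ≠ w ∧ ((2 : ℕ) : 𝓞 K) ∈ v.asIdeal ∧
        ((2 : ℕ) : 𝓞 K) ∈ w.asIdeal) →
      ∃ hcpt : isCompact_glFiniteIntegralLevel 2 K, Nonempty (CuspidalAutomorphicRepData 2 K hcpt)) :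
    IcosahedralDescentLevel ↔
      ∀ ρ : FramedGaloisRep ℚ ℂ 2, ρ.toGaloisRep.IsIrreducible →
        Nonempty ((Matrix.ProjGenLinGroup.mk.comp ρ.toMonoidHom).range ≃* alternatingGroup (Fin 5)) →
        ∃ (hcpt : isCompact_glFiniteIntegralLevel 2 ℚ) (π : CuspidalAutomorphicRepData 2 ℚ hcpt),
          ∀ᶠ v : HeightOneSpectrum (𝓞 ℚ) in cofinite, ∃ α : Multiset ℂ,
            π.1.HasSatakeParamAt v α ∧ ρ.IsUnramifiedAt v ∧
              ρ.HasFrobCharpolyAt v (satakePolynomial α) :=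
  ⟨fun hD ρ hirr hA5 => Negative.allParity_of_descent_of_inhabited hD hinh ρ hirr hA5,
    fun h _ ρ hirr hA5 _ => h ρ hirr hA5⟩

end Summit.Langlands.Langlands.Theorems.IcosahedralDescentLevel

end
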